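import Summits.NavierStokesRegularity.NavierStokesRegularity.Theorems.WakeRatchetEternalInviscidRateConveyorMassInvariant
import Summits.NavierStokesRegularity.NavierStokesRegularity.Theorems.WakeRatchetBlockRatioLeOne

/-!
# Conveyor ledger (crux `WakeRatchet.EternalInviscidRate`, ⟨stmt-NavierStokesRegularity-25646⟩) —
# `stub_noConveyor` DECIDED on the block-self-similar stratum: the conveyor dichotomy

Helpers for the registered skeleton «conveyor ledger» (LINE g10-3, sha16 d183ebc25b56, namespace
`…Cruxes.EternalInviscidRate.FinalWakeLedger`).  MODEL lattice only (Tao 2016 §4 renormalised cascade, cell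
vocabulary `physEnergy` / `UniformBound` / `IsEternalVisc` / `IsDSSWave`); nothing here is a statement about the
Navier–Stokes equations and no summit is proved by this file.

Setting: a shell field `W` with summable physical energy tails, FINAL WAKES `ω k = lim_σ E_k(σ)` and FINAL TAILS
`L n = lim_σ Σ_{k≥0} E_{n+k}(σ)` supplied by hypothesis (they exist for bounded admissible eternal solutions by the
landed `stub_wakeLimit` / `stub_tailLimit`), which is BLOCK-SELF-SIMILAR: `W_{n+p}(σ) = W_n(σ − T)` for a shell
period `p ≥ 1` and a lag `T`, with block energy ratio `ϱ = e^{2T} Λ^{-2p}` (tree: `WakeRatchetDSS.physEnergy_shift`,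
`tail_shift`).  Every DSS wave (`IsDSSWave`, shape permutation `π`) carries such a field with `p = |π|`,
`ϱ = dssMu^{|π|}` (`WakeRatchetDSS.dssEmbed_shift`, `blockRatio_orderOf_eq_pow`).

* `finalTail_block`, `finalWake_tsum_block` — block splitting of final tails / final-wake sums (bookkeeping over the
  landed `finalTail_succ`, `finalWake_summable`).
* `finalWake_blockShift`, `finalTail_blockShift` — final wakes and final tails scale by `ϱ` along the block shift.
* `blockDSS_noConveyor` — **`ϱ < 1` ⇒ NO CONVEYOR MASS**: `L n = Σ_k ω (n+k)` at every shell, i.e. the inner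
  conclusion of `NoConveyor R` (the open stub `stub_noConveyor`) holds for this `W`; equivalently
  `conveyorMass ω L n = 0` (`blockDSS_conveyorMass_eq_zero`).
* `blockDSS_unitary_wakeless` — **`ϱ = 1` (the perfect conveyor) ⇒ `ω ≡ 0`**: a unitary block-self-similar field
  leaves no wake at all; and if it is uniformly bounded and non-zero its conveyor mass is STRICTLY POSITIVE
  (`blockDSS_unitary_conveyorMass_pos`), so the inner conclusion of `NoConveyor` FAILS for it.
* `blockDSS_dichotomy` — for a uniformly bounded admissible eternal solution (any covariant viscosity `ν̂ ≥ 0`) of a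
  cancelling table that is block-self-similar, the landed sub-unitarity `WakeRatchetDSS.blockRatio_le_one` leaves
  exactly these two cases: NO CONVEYOR MASS, or WAKELESS.  `dssWave_dichotomy` / `dssWave_noConveyor` restate it for
  `IsDSSWave` profiles (`dssMu < 1` ⇒ no conveyor mass).
Reading for the crux: on the block-self-similar stratum `stub_noConveyor` is equivalent to the Liouville statement
«no non-trivial uniformly bounded UNITARY (`ϱ = 1`) block-self-similar inviscid eternal solution on an `E₂(R)` table
at small `ε₀`» (Tao's own blow-up mechanism is the unitary conveyor, on a table of unbounded spread); its content
beyond that stratum is the non-self-similar case.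
-/

noncomputable section

set_option linter.dupNamespace false

open Filter Topology
open Literature.Analysis.FluidPDE Literature.Analysis.FluidPDE.TaoCascade
open Summit.NavierStokesRegularity.NavierStokesRegularity.Theorems

namespace Summit.NavierStokesRegularity.NavierStokesRegularity.Cruxes.EternalInviscidRate.FinalWakeLedger

variable {m : ℕ} {ε₀ : ℝ} {W : ℤ → ℝ → Em m}

/-! ## Block bookkeeping of final wakes and final tails -/

section Ledger
variable (hS : ∀ (n : ℤ) (σ : ℝ), Summable (fun k : ℕ => physEnergy ε₀ W (n + k) σ))
  {ω : ℤ → ℝ} (hω : ∀ k : ℤ, Tendsto (physEnergy ε₀ W k) atTop (𝓝 (ω k)))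
  {L : ℤ → ℝ} (hL : ∀ n : ℤ, Tendsto (fun σ => ∑' k : ℕ, physEnergy ε₀ W (n + k) σ) atTop (𝓝 (L n)))
include hS hω hL

/-- Final tails split off a block of `p` final wakes: `L n = Σ_{j<p} ω (n+j) + L (n+p)`. -/
theorem finalTail_block (n : ℤ) (p : ℕ) :
    L n = ∑ j ∈ Finset.range p, ω (n + j) + L (n + p) := by
  induction p with
  | zero => simp
  | succ p ih =>
    rw [Finset.sum_range_succ, ih, finalTail_succ hS hω hL (n + p)]
    push_cast
    ring

/-- The sum of the final wakes splits off the same block: `Σ_k ω (n+k) = Σ_{j<p} ω (n+j) + Σ_k ω (n+p+k)`. -/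
theorem finalWake_tsum_block (n : ℤ) (p : ℕ) :
    ∑' k : ℕ, ω (n + k) = ∑ j ∈ Finset.range p, ω (n + j) + ∑' k : ℕ, ω (n + p + k) := by
  have h := (finalWake_summable hS hω hL n).sum_add_tsum_nat_add p
  have e : (fun k : ℕ => ω (n + ((k + p : ℕ) : ℤ))) = fun k : ℕ => ω (n + p + k) := by
    funext k; push_cast; ring_nf
  rw [e] at h
  exact h.symm

end Ledger

/-! ## Scaling along the block shift -/

/-- Final wakes of a block-self-similar field scale by the block ratio: `ω (k+p) = ϱ · ω k`. -/
theorem finalWake_blockShift (hε : 0 < ε₀) {p : ℕ} {T : ℝ}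
    (hD : ∀ (n : ℤ) (σ : ℝ), W (n + p) σ = W n (σ - T))
    {ω : ℤ → ℝ} (hω : ∀ k : ℤ, Tendsto (physEnergy ε₀ W k) atTop (𝓝 (ω k))) (k : ℤ) :
    ω (k + p) = Real.exp (2 * T) * (bigLam ε₀ ^ p)⁻¹ ^ 2 * ω k := by
  have hshift : Tendsto (fun σ : ℝ => σ - T) atTop atTop := tendsto_atTop_add_const_right _ _ tendsto_id
  have h1 : Tendsto (fun σ => physEnergy ε₀ W (k + p) σ) atTop
      (𝓝 (Real.exp (2 * T) * (bigLam ε₀ ^ p)⁻¹ ^ 2 * ω k)) := by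
    have e : (fun σ => physEnergy ε₀ W (k + p) σ)
        = fun σ => Real.exp (2 * T) * (bigLam ε₀ ^ p)⁻¹ ^ 2 * physEnergy ε₀ W k (σ - T) :=
      funext fun σ => WakeRatchetDSS.physEnergy_shift hε hD k σ
    rw [e]
    exact ((hω k).comp hshift).const_mul _
  exact tendsto_nhds_unique (hω (k + p)) h1

/-- Final tails of a block-self-similar field scale by the block ratio: `L (n+p) = ϱ · L n`. -/
theorem finalTail_blockShift (hε : 0 < ε₀) {p : ℕ} {T : ℝ}
    (hD : ∀ (n : ℤ) (σ : ℝ), W (n + p) σ = W n (σ - T))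
    {L : ℤ → ℝ} (hL : ∀ n : ℤ, Tendsto (fun σ => ∑' k : ℕ, physEnergy ε₀ W (n + k) σ) atTop (𝓝 (L n)))
    (n : ℤ) : L (n + p) = Real.exp (2 * T) * (bigLam ε₀ ^ p)⁻¹ ^ 2 * L n := by
  have hshift : Tendsto (fun σ : ℝ => σ - T) atTop atTop := tendsto_atTop_add_const_right _ _ tendsto_id
  have h1 : Tendsto (fun σ => ∑' k : ℕ, physEnergy ε₀ W (n + p + k) σ) atTop
      (𝓝 (Real.exp (2 * T) * (bigLam ε₀ ^ p)⁻¹ ^ 2 * L n)) := by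
    have e : (fun σ => ∑' k : ℕ, physEnergy ε₀ W (n + p + k) σ)
        = fun σ => Real.exp (2 * T) * (bigLam ε₀ ^ p)⁻¹ ^ 2 * ∑' k : ℕ, physEnergy ε₀ W (n + k) (σ - T) :=
      funext fun σ => WakeRatchetDSS.tail_shift hε hD n σ
    rw [e]
    exact ((hL n).comp hshift).const_mul _
  exact tendsto_nhds_unique (hL (n + p)) h1

/-! ## The dichotomy -/

/-- **Sub-unitary block-self-similar ⇒ no conveyor mass** (`stub_noConveyor` on this stratum).  If `W` is
block-self-similar with shell period `p ≥ 1` and block ratio `ϱ = e^{2T}Λ^{-2p} < 1`, then every final tail equals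
the sum of the final wakes above it. -/
theorem blockDSS_noConveyor (hε : 0 < ε₀) {p : ℕ} (hp : 0 < p) {T : ℝ}
    (hD : ∀ (n : ℤ) (σ : ℝ), W (n + p) σ = W n (σ - T))
    (hϱ : Real.exp (2 * T) * (bigLam ε₀ ^ p)⁻¹ ^ 2 < 1)
    (hS : ∀ (n : ℤ) (σ : ℝ), Summable (fun k : ℕ => physEnergy ε₀ W (n + k) σ))
    {ω : ℤ → ℝ} (hω : ∀ k : ℤ, Tendsto (physEnergy ε₀ W k) atTop (𝓝 (ω k)))
    {L : ℤ → ℝ} (hL : ∀ n : ℤ, Tendsto (fun σ => ∑' k : ℕ, physEnergy ε₀ W (n + k) σ) atTop (𝓝 (L n)))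
    (n : ℤ) : L n = ∑' k : ℕ, ω (n + k) := by
  have _hp := hp
  set ϱ : ℝ := Real.exp (2 * T) * (bigLam ε₀ ^ p)⁻¹ ^ 2 with hϱdef
  set S : ℝ := ∑ j ∈ Finset.range p, ω (n + j) with hSdef
  -- the final tail solves `L n = S + ϱ L n`
  have hLn : L n = S + ϱ * L n := by
    rw [← finalTail_blockShift hε hD hL n]
    exact finalTail_block hS hω hL n p
  -- the sum of final wakes solves the same equation
  have hX : ∑' k : ℕ, ω (n + k) = S + ϱ * ∑' k : ℕ, ω (n + k) := by
    have htail : ∑' k : ℕ, ω (n + p + k) = ϱ * ∑' k : ℕ, ω (n + k) := by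
      rw [← tsum_mul_left]
      refine tsum_congr fun k => ?_
      rw [show n + (p : ℤ) + (k : ℤ) = n + k + p by ring]
      exact finalWake_blockShift hε hD hω (n + k)
    rw [← htail]
    exact finalWake_tsum_block hS hω hL n p
  -- unique solution since `ϱ < 1`
  have h1 : (1 - ϱ) * L n = (1 - ϱ) * ∑' k : ℕ, ω (n + k) := by linarith
  exact mul_left_cancel₀ (by linarith : (1 - ϱ) ≠ 0) h1

/-- The same, as vanishing of the conveyor mass. -/
theorem blockDSS_conveyorMass_eq_zero (hε : 0 < ε₀) {p : ℕ} (hp : 0 < p) {T : ℝ}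
    (hD : ∀ (n : ℤ) (σ : ℝ), W (n + p) σ = W n (σ - T))
    (hϱ : Real.exp (2 * T) * (bigLam ε₀ ^ p)⁻¹ ^ 2 < 1)
    (hS : ∀ (n : ℤ) (σ : ℝ), Summable (fun k : ℕ => physEnergy ε₀ W (n + k) σ))
    {ω : ℤ → ℝ} (hω : ∀ k : ℤ, Tendsto (physEnergy ε₀ W k) atTop (𝓝 (ω k)))
    {L : ℤ → ℝ} (hL : ∀ n : ℤ, Tendsto (fun σ => ∑' k : ℕ, physEnergy ε₀ W (n + k) σ) atTop (𝓝 (L n)))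
    (n : ℤ) : conveyorMass ω L n = 0 := by
  unfold conveyorMass
  rw [blockDSS_noConveyor hε hp hD hϱ hS hω hL n, sub_self]

/-- **Unitary block-self-similar ⇒ wakeless** (the perfect conveyor leaves no wake).  If `ϱ = 1` then every
final wake vanishes. -/
theorem blockDSS_unitary_wakeless (hε : 0 < ε₀) {p : ℕ} (hp : 0 < p) {T : ℝ}
    (hD : ∀ (n : ℤ) (σ : ℝ), W (n + p) σ = W n (σ - T))
    (hϱ : Real.exp (2 * T) * (bigLam ε₀ ^ p)⁻¹ ^ 2 = 1)
    (hS : ∀ (n : ℤ) (σ : ℝ), Summable (fun k : ℕ => physEnergy ε₀ W (n + k) σ))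
    {ω : ℤ → ℝ} (hω : ∀ k : ℤ, Tendsto (physEnergy ε₀ W k) atTop (𝓝 (ω k)))
    {L : ℤ → ℝ} (hL : ∀ n : ℤ, Tendsto (fun σ => ∑' k : ℕ, physEnergy ε₀ W (n + k) σ) atTop (𝓝 (L n)))
    (k : ℤ) : ω k = 0 := by
  -- the block of `p` final wakes above `k` sums to zero
  have hLk : L (k + p) = L k := by rw [finalTail_blockShift hε hD hL k, hϱ, one_mul]
  have hsum : ∑ j ∈ Finset.range p, ω (k + j) = 0 := by
    have h := finalTail_block hS hω hL k p
    rw [hLk] at h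
    linarith
  have hmem : 0 ∈ Finset.range p := Finset.mem_range.mpr hp
  have h := (Finset.sum_eq_zero_iff_of_nonneg
    (fun j (_ : j ∈ Finset.range p) => finalWake_nonneg hω (k + (j : ℤ)))).mp hsum 0 hmem
  simpa using h

/-- For a unitary block-self-similar field all final tails coincide (the conveyor mass is the whole tail). -/
theorem blockDSS_unitary_finalTail_const (hε : 0 < ε₀) {p : ℕ} (hp : 0 < p) {T : ℝ}
    (hD : ∀ (n : ℤ) (σ : ℝ), W (n + p) σ = W n (σ - T))
    (hϱ : Real.exp (2 * T) * (bigLam ε₀ ^ p)⁻¹ ^ 2 = 1)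
    (hS : ∀ (n : ℤ) (σ : ℝ), Summable (fun k : ℕ => physEnergy ε₀ W (n + k) σ))
    {ω : ℤ → ℝ} (hω : ∀ k : ℤ, Tendsto (physEnergy ε₀ W k) atTop (𝓝 (ω k)))
    {L : ℤ → ℝ} (hL : ∀ n : ℤ, Tendsto (fun σ => ∑' k : ℕ, physEnergy ε₀ W (n + k) σ) atTop (𝓝 (L n)))
    (n : ℤ) : L (n + 1) = L n := by
  have h := finalTail_succ hS hω hL n
  rw [blockDSS_unitary_wakeless hε hp hD hϱ hS hω hL n, zero_add] at h
  exact h.symm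

/-- **The perfect conveyor is a conveyor.**  A uniformly bounded, NON-ZERO, unitary (`ϱ = 1`) block-self-similar
field has strictly positive conveyor mass; in particular the inner conclusion of `NoConveyor` fails for it
(`L n ≠ Σ_k ω (n+k)`).  (Unitarity with `p ≥ 1` forces `T > 0`; tails nest and are `T`-periodic up to the
shell shift, so `T_n(σ) ≤ L n` for every `σ`, and `L n = 0` would force `W ≡ 0`.) -/
theorem blockDSS_unitary_conveyorMass_pos (hε : 0 < ε₀) (hU : UniformBound W) {p : ℕ} (hp : 0 < p) {T : ℝ}
    (hD : ∀ (n : ℤ) (σ : ℝ), W (n + p) σ = W n (σ - T))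
    (hϱ : Real.exp (2 * T) * (bigLam ε₀ ^ p)⁻¹ ^ 2 = 1)
    {ω : ℤ → ℝ} (hω : ∀ k : ℤ, Tendsto (physEnergy ε₀ W k) atTop (𝓝 (ω k)))
    {L : ℤ → ℝ} (hL : ∀ n : ℤ, Tendsto (fun σ => ∑' k : ℕ, physEnergy ε₀ W (n + k) σ) atTop (𝓝 (L n)))
    {n₀ : ℤ} {σ₀ : ℝ} (hne : W n₀ σ₀ ≠ 0) (n : ℤ) : 0 < conveyorMass ω L n := by
  have hS : ∀ (n : ℤ) (σ : ℝ), Summable (fun k : ℕ => physEnergy ε₀ W (n + k) σ) :=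
    summable_physEnergy_tail_cm hε hU
  have hΛ : 0 < bigLam ε₀ := bigLam_pos (by linarith)
  have hΛ1 : 1 < bigLam ε₀ := EternalViscousRate.DissipationEdge.one_lt_bigLam hε
  -- `T > 0`: `e^{2T} = Λ^{2p} > 1`
  have hT : 0 < T := by
    have hpow : 1 < (bigLam ε₀ ^ p) ^ 2 := by
      have h1 : 1 < bigLam ε₀ ^ p := one_lt_pow₀ hΛ1 hp.ne'
      nlinarith
    have hexp : Real.exp (2 * T) = (bigLam ε₀ ^ p) ^ 2 := by
      have hne' : (bigLam ε₀ ^ p)⁻¹ ^ 2 ≠ 0 := by positivity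
      have := hϱ
      rw [inv_pow] at this
      field_simp at this
      linarith
    have : 1 < Real.exp (2 * T) := by rw [hexp]; exact hpow
    have := Real.one_lt_exp_iff.mp this  -- hmm name
    linarith
  -- the conveyor mass is the same at every shell and equals `L n₀` (wakeless)
  have hω0 : ∀ k : ℤ, ω k = 0 := blockDSS_unitary_wakeless hε hp hD hϱ hS hω hL
  have hm : conveyorMass ω L n = L n₀ := by
    rw [conveyorMass_const hS hω hL n n₀]
    unfold conveyorMass
    simp [hω0]
  -- tails are dominated by the final tail: `T_{n₀}(σ) ≤ T_{n₀}(σ + jT) → L n₀`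
  have hstep : ∀ σ : ℝ, ∑' k : ℕ, physEnergy ε₀ W (n₀ + k) σ ≤ ∑' k : ℕ, physEnergy ε₀ W (n₀ + k) (σ + T) := by
    intro σ
    have h := WakeRatchetDSS.tail_shift hε hD n₀ (σ + T)
    rw [hϱ, one_mul, add_sub_cancel_right] at h
    rw [← h]
    exact WakeRatchetDSS.tail_add_le_tail hε hU n₀ p (σ + T)
  have hiter : ∀ (j : ℕ) (σ : ℝ), ∑' k : ℕ, physEnergy ε₀ W (n₀ + k) σ
      ≤ ∑' k : ℕ, physEnergy ε₀ W (n₀ + k) (σ + j * T) := by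
    intro j
    induction j with
    | zero => intro σ; simp
    | succ j ih =>
      intro σ
      have h := hstep (σ + j * T)
      have e : σ + j * T + T = σ + ((j + 1 : ℕ) : ℝ) * T := by push_cast; ring
      rw [e] at h
      exact (ih σ).trans h
  have hle : ∀ σ : ℝ, ∑' k : ℕ, physEnergy ε₀ W (n₀ + k) σ ≤ L n₀ := by
    intro σ
    have hj : Tendsto (fun j : ℕ => σ + (j : ℝ) * T) atTop atTop :=
      tendsto_atTop_add_const_left _ _ (tendsto_natCast_atTop_atTop.atTop_mul_const hT)
    exact ge_of_tendsto' ((hL n₀).comp hj) fun j => hiter j σ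
  -- a non-zero shell value makes the tail, hence `L n₀`, positive
  have hpos : 0 < ∑' k : ℕ, physEnergy ε₀ W (n₀ + k) σ₀ := by
    have h0 : 0 < physEnergy ε₀ W n₀ σ₀ := by
      unfold physEnergy
      have : 0 < ‖W n₀ σ₀‖ := norm_pos_iff.mpr hne
      positivity
    have h1 : physEnergy ε₀ W (n₀ + ((0 : ℕ) : ℤ)) σ₀ ≤ ∑' k : ℕ, physEnergy ε₀ W (n₀ + k) σ₀ :=
      (hS n₀ σ₀).le_tsum 0 (fun j _ => physEnergy_nonneg _ _ _ _)
    simp only [Nat.cast_zero, add_zero] at h1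
    exact h0.trans_le h1
  rw [hm]
  exact hpos.trans_le (hle σ₀)

/-- **The conveyor dichotomy for bounded admissible block-self-similar eternal solutions.**  On a cancelling table
(`ε₀ > 0`, any covariant viscosity `ν̂ ≥ 0`), a uniformly bounded admissible eternal solution with
`W_{n+p}(σ) = W_n(σ − T)` (`p ≥ 1`) either has NO CONVEYOR MASS (every final tail is the sum of the final wakes
above it) or is WAKELESS (every final wake vanishes) — by the landed sub-unitarity `blockRatio_le_one`. -/
theorem blockDSS_dichotomy (hε : 0 < ε₀) {νh : ℝ} {α : Fin m → Fin m → Fin m → ℤ × ℤ × ℤ → ℝ}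
    (hc : IsCancellingCoeff α) (hW : IsEternalVisc ε₀ νh α W) (hU : UniformBound W)
    {p : ℕ} (hp : 0 < p) {T : ℝ} (hD : ∀ (n : ℤ) (σ : ℝ), W (n + p) σ = W n (σ - T))
    {ω : ℤ → ℝ} (hω : ∀ k : ℤ, Tendsto (physEnergy ε₀ W k) atTop (𝓝 (ω k)))
    {L : ℤ → ℝ} (hL : ∀ n : ℤ, Tendsto (fun σ => ∑' k : ℕ, physEnergy ε₀ W (n + k) σ) atTop (𝓝 (L n))) :
    (∀ n : ℤ, L n = ∑' k : ℕ, ω (n + k)) ∨ (∀ k : ℤ, ω k = 0) := by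
  have hS : ∀ (n : ℤ) (σ : ℝ), Summable (fun k : ℕ => physEnergy ε₀ W (n + k) σ) :=
    summable_physEnergy_tail_cm hε hU
  by_cases hz : ∀ (n : ℤ) (σ : ℝ), W n σ = 0
  · -- the zero field: every final wake is zero
    refine Or.inr fun k => ?_
    have h0 : Tendsto (physEnergy ε₀ W k) atTop (𝓝 0) := by
      have e : physEnergy ε₀ W k = fun _ => 0 := by
        funext σ; unfold physEnergy; rw [hz k σ, norm_zero]; ring
      rw [e]; exact tendsto_const_nhds
    exact tendsto_nhds_unique (hω k) h0
  · push Not at hz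
    obtain ⟨n₀, σ₀, hne⟩ := hz
    have hle := WakeRatchetDSS.blockRatio_le_one hε hc hW hU hD hne
    rcases hle.lt_or_eq with hlt | heq
    · exact Or.inl (blockDSS_noConveyor hε hp hD hlt hS hω hL)
    · exact Or.inr (blockDSS_unitary_wakeless hε hp hD heq hS hω hL)

/-! ## DSS waves -/

/-- **The conveyor dichotomy for admissible DSS waves.**  For an admissible DSS wave of a cancelling table
(`IsDSSWave`, any period, any shape permutation `π`), the eternal solution `dssEmbed π T Φ r` it carries either
has no conveyor mass or is wakeless. -/
theorem dssWave_dichotomy {ρ : Type*} [Fintype ρ] {α : Fin m → Fin m → Fin m → ℤ × ℤ × ℤ → ℝ}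
    {π : Equiv.Perm ρ} {T : ℝ} {Φ : ρ → ℝ → Em m} (hε : 0 < ε₀) (hc : IsCancellingCoeff α)
    (h : IsDSSWave ε₀ α π T Φ) (r : ρ)
    {ω : ℤ → ℝ} (hω : ∀ k : ℤ, Tendsto (physEnergy ε₀ (dssEmbed π T Φ r) k) atTop (𝓝 (ω k)))
    {L : ℤ → ℝ}
    (hL : ∀ n : ℤ, Tendsto (fun σ => ∑' k : ℕ, physEnergy ε₀ (dssEmbed π T Φ r) (n + k) σ) atTop (𝓝 (L n))) :
    (∀ n : ℤ, L n = ∑' k : ℕ, ω (n + k)) ∨ (∀ k : ℤ, ω k = 0) :=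
  blockDSS_dichotomy hε hc (νh := 0) (h.isEternal_dssEmbed r).isEternalVisc (uniformBound_dssEmbed h r)
    (orderOf_pos π) (WakeRatchetDSS.dssEmbed_shift π T Φ r) hω hL

/-- **Strictly sub-unitary DSS waves have no conveyor mass** (`stub_noConveyor` on the DSS stratum, in the
crux frame: only `UniformBound` of the embedded solution and `dssMu < 1` are used besides the final wakes/tails). -/
theorem dssWave_noConveyor {ρ : Type*} [Fintype ρ] {π : Equiv.Perm ρ} {T : ℝ} {Φ : ρ → ℝ → Em m}
    (hε : 0 < ε₀) (r : ρ) (hU : UniformBound (dssEmbed π T Φ r)) (hμ : dssMu ε₀ T < 1)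
    {ω : ℤ → ℝ} (hω : ∀ k : ℤ, Tendsto (physEnergy ε₀ (dssEmbed π T Φ r) k) atTop (𝓝 (ω k)))
    {L : ℤ → ℝ}
    (hL : ∀ n : ℤ, Tendsto (fun σ => ∑' k : ℕ, physEnergy ε₀ (dssEmbed π T Φ r) (n + k) σ) atTop (𝓝 (L n)))
    (n : ℤ) : L n = ∑' k : ℕ, ω (n + k) := by
  have hp : 0 < orderOf π := orderOf_pos π
  have hϱ : Real.exp (2 * ((orderOf π : ℕ) * T)) * (bigLam ε₀ ^ orderOf π)⁻¹ ^ 2 < 1 := by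
    rw [WakeRatchetDSS.blockRatio_orderOf_eq_pow hε.le]
    exact pow_lt_one₀ (dssMu_pos T (by linarith)).le hμ hp.ne'
  exact blockDSS_noConveyor hε hp (WakeRatchetDSS.dssEmbed_shift π T Φ r) hϱ
    (summable_physEnergy_tail_cm hε hU) hω hL n

end Summit.NavierStokesRegularity.NavierStokesRegularity.Cruxes.EternalInviscidRate.FinalWakeLedger

end
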